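import Literature.NumberTheory.DiophantineGeometry.TateAlgorithmInvarianceProofs
import Literature.NumberTheory.DiophantineGeometry.TateAlgorithmOggBound
import Literature.NumberTheory.DiophantineGeometry.TateAlgorithmPerfectField
import HarnessLib

/-!
# Tate's algorithm read on normalised models: forward evaluation of types II, III, IV, I₀*, IV*,
# III*, II*

`Proofs` file (theorems only, no definitions, no named facts) in topic
`NumberTheory/DiophantineGeometry`, sibling of `TateAlgorithmIstarEvalProofs` (which did the same
for the `Iₙ*` branch), landed by the seat of bsd.S15
(`Literature.NumberTheory.EllipticCurves.conductorNorm_eq_artinConductorNat`) as a tool for the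
discriminant side of Ogg's formula at `2` (next: the Mordell curves `y² = x³ + k` over `ℚ₂`).

The tree's literal implementation `WeierstrassCurve.kodairaSymbolOfMinimal` of Silverman *ATAEC*
IV.9.4 makes its normalising translations through `Exists.choose`, so that its value on an explicit
equation cannot be computed by unfolding.  The *converse* direction (type ⇒ normal form,
`exists_smul_of_kodairaSymbolOfMinimal_eq_…`) and the *invariance* of the output
(`kodairaSymbolOfMinimal_smul`, `TateAlgorithmInvarianceProofs`) are theorems of the tree; this
file supplies the **forward** direction: if a model is already normalised up to the step at which
it exits and the exit test holds on it, the algorithm returns that type —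

* `kodairaSymbolOfMinimal_eq_II_of_step2`, `…_III_of_step2`, `…_IV_of_step2` — on a step-2
  normalised model (`π ∣ a₃, a₄, a₆`, `π ∣ b₂`, `π ∣ Δ`): `π² ∤ a₆` gives `II`; `π² ∣ a₆`,
  `π³ ∤ b₈` gives `III`; `π² ∣ a₆`, `π³ ∣ b₈`, `π³ ∤ b₆` gives `IV`;
* `kodairaSymbolOfMinimal_eq_Istar_zero_of_step6` — on a step-6 normalised model (`π ∣ a₁, a₂`,
  `π² ∣ a₃, a₄`, `π³ ∣ a₆`; the earlier tests then fail, `tests_of_step6`) whose cubic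
  `T³ + a₂,₁T² + a₄,₂T + a₆,₃` has three distinct roots in `k̄`: `I₀*`;
* `kodairaSymbolOfMinimal_eq_IVstar_of_step8` — on a step-8 normalised model (`π ∣ a₁`,
  `π² ∣ a₂, a₃`, `π³ ∣ a₄`, `π⁴ ∣ a₆`; cubic `T³`) whose quadratic `Y² + a₃,₂Y - a₆,₄` has two
  distinct roots: `IV*`;
* `kodairaSymbolOfMinimal_eq_IIIstar_of_step9`, `…_IIstar_of_step9` — on a step-9 normalised
  model (`π ∣ a₁`, `π² ∣ a₂`, `π³ ∣ a₃, a₄`, `π⁵ ∣ a₆`; quadratic `Y²`): `π⁴ ∤ a₄` gives `III*`;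
  `π⁴ ∣ a₄`, `π⁶ ∤ a₆` gives `II*`.

Proof (one run of the coupling argument of `kodairaSymbolOfMinimal_smul` against the identity):
the algorithm's own model at each step differs from the given one by a change of variables with
`u = 1` whose translation part is constrained by rigidity (`dvd_r_t_of_step2`,
`dvd_r_s_t_of_step6/8/9`), under which every test is invariant (`dvd_b₂_smul_iff`,
`sq_dvd_a₆_smul_iff`, `cube_dvd_b₈_smul_iff`, `cube_dvd_b₆_smul_iff`,
`distinctRootCount_cubicStep6_smul`, `distinctRootCount_quadraticStep8_smul`,
`pow_four_dvd_a₄_smul_iff`, `pow_six_dvd_a₆_smul_iff`).  Perfect residue field (existence of the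
normalisations); no assumption on the residue characteristic; no minimality hypothesis (the
statements are about the literal function; for a minimal model they are the Kodaira type).

## References

* J. H. Silverman, *Advanced Topics in the Arithmetic of Elliptic Curves*, GTM 151 (1994), IV.9.4,
  Tate's algorithm, Steps 1–10 (PDF pp. 344–346). [SilvermanATAEC1994]
* J. Tate, *Algorithm for determining the type of a singular fiber in an elliptic pencil*, in
  Modular Functions of One Variable IV, LNM 476 (1975), §§7–8. [Tate1975]
-/

noncomputable section

open Polynomial IsLocalRing
open IsDiscreteValuationRing hiding maximalIdeal

namespace Literature.NumberTheory.DiophantineGeometry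

namespace TateAlgorithm

variable {R : Type*} [CommRing R] [IsDomain R] [IsDiscreteValuationRing R]

omit [IsDomain R] [IsDiscreteValuationRing R] in
/-- If `d ∣ b₂, b₄, b₆, b₈` then `d ∣ Δ = -b₂²b₈ - 8b₄³ - 27b₆² + 9b₂b₄b₆`. [folklore] -/
theorem dvd_Δ_of_dvd_b {W : WeierstrassCurve R} {d : R} (h2 : d ∣ W.b₂) (h4 : d ∣ W.b₄)
    (h6 : d ∣ W.b₆) (h8 : d ∣ W.b₈) : d ∣ W.Δ := by
  obtain ⟨B₂, hB₂⟩ := h2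
  obtain ⟨B₄, hB₄⟩ := h4
  obtain ⟨B₆, hB₆⟩ := h6
  obtain ⟨B₈, hB₈⟩ := h8
  exact ⟨-(d ^ 2 * B₂ ^ 2 * B₈) - 8 * d ^ 2 * B₄ ^ 3 - 27 * d * B₆ ^ 2 + 9 * d ^ 2 * B₂ * B₄ * B₆,
    by rw [WeierstrassCurve.Δ, hB₂, hB₄, hB₆, hB₈]; ring⟩

/-- On a step-6 normalised model (`π ∣ a₁, a₂`, `π² ∣ a₃, a₄`, `π³ ∣ a₆`) the tests of Steps 1–5
fail: `π ∣ Δ`, `π ∣ a₃, a₄, a₆`, `π ∣ b₂`, `π² ∣ a₆`, `π³ ∣ b₈`, `π³ ∣ b₆`. [folklore] -/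
theorem tests_of_step6 {W : WeierstrassCurve R} (q1 : uniformizer R ∣ W.a₁)
    (q2 : uniformizer R ∣ W.a₂) (q3 : uniformizer R ^ 2 ∣ W.a₃) (q4 : uniformizer R ^ 2 ∣ W.a₄)
    (q6 : uniformizer R ^ 3 ∣ W.a₆) :
    uniformizer R ∣ W.Δ ∧ uniformizer R ∣ W.a₃ ∧ uniformizer R ∣ W.a₄ ∧ uniformizer R ∣ W.a₆ ∧
      uniformizer R ∣ W.b₂ ∧ uniformizer R ^ 2 ∣ W.a₆ ∧ uniformizer R ^ 3 ∣ W.b₈ ∧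
      uniformizer R ^ 3 ∣ W.b₆ := by
  obtain ⟨α, hα⟩ := q1
  obtain ⟨β, hβ⟩ := q2
  obtain ⟨γ, hγ⟩ := q3
  obtain ⟨δ, hδ⟩ := q4
  obtain ⟨ε, hε⟩ := q6
  have hb₂ : uniformizer R ∣ W.b₂ :=
    ⟨uniformizer R * α ^ 2 + 4 * β, by rw [WeierstrassCurve.b₂, hα, hβ]; ring⟩
  have hb₄ : uniformizer R ∣ W.b₄ :=
    ⟨2 * uniformizer R * δ + uniformizer R ^ 2 * α * γ, by rw [WeierstrassCurve.b₄, hα, hγ, hδ]; ring⟩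
  have hb₈ : uniformizer R ^ 3 ∣ W.b₈ :=
    ⟨uniformizer R ^ 2 * α ^ 2 * ε + 4 * uniformizer R * β * ε - uniformizer R ^ 2 * α * γ * δ
      + uniformizer R ^ 2 * β * γ ^ 2 - uniformizer R * δ ^ 2,
      by rw [WeierstrassCurve.b₈, hα, hβ, hγ, hδ, hε]; ring⟩
  have hb₆ : uniformizer R ^ 3 ∣ W.b₆ :=
    ⟨uniformizer R * γ ^ 2 + 4 * ε, by rw [WeierstrassCurve.b₆, hγ, hε]; ring⟩
  have d13 : uniformizer R ∣ uniformizer R ^ 3 := dvd_pow_self _ three_ne_zero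
  refine ⟨dvd_Δ_of_dvd_b hb₂ hb₄ (d13.trans hb₆) (d13.trans hb₈),
    ⟨uniformizer R * γ, by rw [hγ]; ring⟩, ⟨uniformizer R * δ, by rw [hδ]; ring⟩,
    ⟨uniformizer R ^ 2 * ε, by rw [hε]; ring⟩, hb₂, ⟨uniformizer R * ε, by rw [hε]; ring⟩,
    hb₈, hb₆⟩

/-- **Steps 1–3 read on a step-2 normalised model: type `II`.**  If `π ∣ a₃, a₄, a₆`
(the singular point of the reduction at `(0,0)`), `π ∣ b₂` and `π² ∤ a₆`, then Tate's algorithm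
returns `II` — whatever step-2 translation the algorithm chooses, it differs from the identity by
`π ∣ r, t` (`dvd_r_t_of_step2`), under which the tests of Steps 2–3 are invariant
(`dvd_b₂_smul_iff`, `sq_dvd_a₆_smul_iff`).  Silverman *ATAEC* IV.9.4, Steps 1–3.
[cite: SilvermanATAEC1994, IV.9.4 Steps 1–3 (PDF pp. 344–345)] -/
theorem kodairaSymbolOfMinimal_eq_II_of_step2 [PerfectField (ResidueField R)]
    {W : WeierstrassCurve R} (hΔ : uniformizer R ∣ W.Δ)
    (n3 : uniformizer R ∣ W.a₃) (n4 : uniformizer R ∣ W.a₄) (n6 : uniformizer R ∣ W.a₆)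
    (hb₂ : uniformizer R ∣ W.b₂) (ha₆ : ¬ uniformizer R ^ 2 ∣ W.a₆) :
    W.kodairaSymbolOfMinimal = .II := by
  classical
  set ϖ := uniformizer R with hϖdef
  unfold WeierstrassCurve.kodairaSymbolOfMinimal
  simp only []
  -- Step 1
  have hΔm : W.Δ ∈ maximalIdeal R := mem_maximalIdeal_iff_dvd.mpr hΔ
  rw [if_neg (not_not.mpr hΔm)]
  -- Step 2 normalisation of the algorithm, compared with `W` itself
  have hex2 := exists_variableChange_step2_of_perfectField W hΔm
  have e2 : normalizeStep2 W = hex2.choose • W := by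
    unfold normalizeStep2; rw [dif_pos hex2]
  rw [e2]
  obtain ⟨hu2, p3, p4, p6⟩ := hex2.choose_spec
  have m3 := mem_maximalIdeal_iff_dvd.mp p3
  have m4 := mem_maximalIdeal_iff_dvd.mp p4
  have m6 := mem_maximalIdeal_iff_dvd.mp p6
  obtain ⟨hr₂, ht₂⟩ := dvd_r_t_of_step2 hu2 n3 n4 n6 m3 m4 m6
  -- Step 2 test
  have hb₂' : ϖ ∣ (hex2.choose • W).b₂ := (dvd_b₂_smul_iff hu2 hr₂).mpr hb₂
  rw [if_neg (not_not.mpr (mem_maximalIdeal_iff_dvd.mpr hb₂'))]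
  -- Step 3 test fires
  have ha₆' : ¬ ϖ ^ 2 ∣ (hex2.choose • W).a₆ := by
    rw [sq_dvd_a₆_smul_iff hu2 n3 n4 hr₂ ht₂]; exact ha₆
  rw [if_pos (fun h ↦ ha₆' (mem_maximalIdeal_pow_iff_dvd.mp h))]

/-- **Steps 1–4 read on a step-2 normalised model: type `III`** (`π ∣ b₂`, `π² ∣ a₆`,
`π³ ∤ b₈`).  Silverman *ATAEC* IV.9.4, Steps 1–4. [cite: SilvermanATAEC1994, IV.9.4 Steps 1–4 (PDF pp. 344–345)] -/
theorem kodairaSymbolOfMinimal_eq_III_of_step2 [PerfectField (ResidueField R)]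
    {W : WeierstrassCurve R} (hΔ : uniformizer R ∣ W.Δ)
    (n3 : uniformizer R ∣ W.a₃) (n4 : uniformizer R ∣ W.a₄) (n6 : uniformizer R ∣ W.a₆)
    (hb₂ : uniformizer R ∣ W.b₂) (ha₆ : uniformizer R ^ 2 ∣ W.a₆)
    (hb₈ : ¬ uniformizer R ^ 3 ∣ W.b₈) :
    W.kodairaSymbolOfMinimal = .III := by
  classical
  set ϖ := uniformizer R with hϖdef
  unfold WeierstrassCurve.kodairaSymbolOfMinimal
  simp only []
  -- Step 1
  have hΔm : W.Δ ∈ maximalIdeal R := mem_maximalIdeal_iff_dvd.mpr hΔ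
  rw [if_neg (not_not.mpr hΔm)]
  -- Step 2 normalisation of the algorithm, compared with `W` itself
  have hex2 := exists_variableChange_step2_of_perfectField W hΔm
  have e2 : normalizeStep2 W = hex2.choose • W := by
    unfold normalizeStep2; rw [dif_pos hex2]
  rw [e2]
  obtain ⟨hu2, p3, p4, p6⟩ := hex2.choose_spec
  have m3 := mem_maximalIdeal_iff_dvd.mp p3
  have m4 := mem_maximalIdeal_iff_dvd.mp p4
  have m6 := mem_maximalIdeal_iff_dvd.mp p6
  obtain ⟨hr₂, ht₂⟩ := dvd_r_t_of_step2 hu2 n3 n4 n6 m3 m4 m6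
  -- Step 2 test
  have hb₂' : ϖ ∣ (hex2.choose • W).b₂ := (dvd_b₂_smul_iff hu2 hr₂).mpr hb₂
  rw [if_neg (not_not.mpr (mem_maximalIdeal_iff_dvd.mpr hb₂'))]
  -- Step 3 test
  have ha₆' : ϖ ^ 2 ∣ (hex2.choose • W).a₆ := (sq_dvd_a₆_smul_iff hu2 n3 n4 hr₂ ht₂).mpr ha₆
  rw [if_neg (not_not.mpr (mem_maximalIdeal_pow_iff_dvd.mpr ha₆'))]
  -- Step 4 test fires
  have hb₈' : ¬ ϖ ^ 3 ∣ (hex2.choose • W).b₈ := by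
    rw [cube_dvd_b₈_smul_iff hu2 n3 n4 ha₆ hr₂]; exact hb₈
  rw [if_pos (fun h ↦ hb₈' (mem_maximalIdeal_pow_iff_dvd.mp h))]

/-- **Steps 1–5 read on a step-2 normalised model: type `IV`** (`π ∣ b₂`, `π² ∣ a₆`, `π³ ∣ b₈`,
`π³ ∤ b₆`).  Silverman *ATAEC* IV.9.4, Steps 1–5. [cite: SilvermanATAEC1994, IV.9.4 Steps 1–5 (PDF pp. 344–345)] -/
theorem kodairaSymbolOfMinimal_eq_IV_of_step2 [PerfectField (ResidueField R)]
    {W : WeierstrassCurve R} (hΔ : uniformizer R ∣ W.Δ)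
    (n3 : uniformizer R ∣ W.a₃) (n4 : uniformizer R ∣ W.a₄) (n6 : uniformizer R ∣ W.a₆)
    (hb₂ : uniformizer R ∣ W.b₂) (ha₆ : uniformizer R ^ 2 ∣ W.a₆)
    (hb₈ : uniformizer R ^ 3 ∣ W.b₈) (hb₆ : ¬ uniformizer R ^ 3 ∣ W.b₆) :
    W.kodairaSymbolOfMinimal = .IV := by
  classical
  set ϖ := uniformizer R with hϖdef
  unfold WeierstrassCurve.kodairaSymbolOfMinimal
  simp only []
  -- Step 1
  have hΔm : W.Δ ∈ maximalIdeal R := mem_maximalIdeal_iff_dvd.mpr hΔ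
  rw [if_neg (not_not.mpr hΔm)]
  -- Step 2 normalisation of the algorithm, compared with `W` itself
  have hex2 := exists_variableChange_step2_of_perfectField W hΔm
  have e2 : normalizeStep2 W = hex2.choose • W := by
    unfold normalizeStep2; rw [dif_pos hex2]
  rw [e2]
  obtain ⟨hu2, p3, p4, p6⟩ := hex2.choose_spec
  have m3 := mem_maximalIdeal_iff_dvd.mp p3
  have m4 := mem_maximalIdeal_iff_dvd.mp p4
  have m6 := mem_maximalIdeal_iff_dvd.mp p6
  obtain ⟨hr₂, ht₂⟩ := dvd_r_t_of_step2 hu2 n3 n4 n6 m3 m4 m6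
  -- Step 2 test
  have hb₂' : ϖ ∣ (hex2.choose • W).b₂ := (dvd_b₂_smul_iff hu2 hr₂).mpr hb₂
  rw [if_neg (not_not.mpr (mem_maximalIdeal_iff_dvd.mpr hb₂'))]
  -- Step 3 test
  have ha₆' : ϖ ^ 2 ∣ (hex2.choose • W).a₆ := (sq_dvd_a₆_smul_iff hu2 n3 n4 hr₂ ht₂).mpr ha₆
  rw [if_neg (not_not.mpr (mem_maximalIdeal_pow_iff_dvd.mpr ha₆'))]
  -- Step 4 test
  have hb₈' : ϖ ^ 3 ∣ (hex2.choose • W).b₈ := (cube_dvd_b₈_smul_iff hu2 n3 n4 ha₆ hr₂).mpr hb₈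
  rw [if_neg (not_not.mpr (mem_maximalIdeal_pow_iff_dvd.mpr hb₈'))]
  -- Step 5 test fires
  have hb₆' : ¬ ϖ ^ 3 ∣ (hex2.choose • W).b₆ := by
    rw [cube_dvd_b₆_smul_iff hu2 n3 ha₆ hb₂ hb₈ hr₂]; exact hb₆
  rw [if_pos (fun h ↦ hb₆' (mem_maximalIdeal_pow_iff_dvd.mp h))]

/-- **Steps 1–6 read on a step-6 normalised model: type `I₀*`.**  If `π ∣ a₁, a₂`, `π² ∣ a₃, a₄`,
`π³ ∣ a₆` and the cubic `T³ + a₂,₁T² + a₄,₂T + a₆,₃` has three distinct roots in `k̄`, Tate's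
algorithm returns `I₀*`: the tests of Steps 1–5 fail on such a model (`tests_of_step6`) and on the
algorithm's step-2 model (rigidity `dvd_r_t_of_step2`); the algorithm's step-6 model differs from
`W` by a change with `π ∣ r, s`, `π² ∣ t` (`dvd_r_s_t_of_step6`), which translates the cubic
(`distinctRootCount_cubicStep6_smul`).  Silverman *ATAEC* IV.9.4, Steps 1–6.
[cite: SilvermanATAEC1994, IV.9.4 Steps 1–6 (PDF pp. 344–346)] -/
theorem kodairaSymbolOfMinimal_eq_Istar_zero_of_step6 [PerfectField (ResidueField R)]
    {W : WeierstrassCurve R} (q1 : uniformizer R ∣ W.a₁) (q2 : uniformizer R ∣ W.a₂)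
    (q3 : uniformizer R ^ 2 ∣ W.a₃) (q4 : uniformizer R ^ 2 ∣ W.a₄)
    (q6 : uniformizer R ^ 3 ∣ W.a₆) (h6 : distinctRootCount (cubicStep6 W) = 3) :
    W.kodairaSymbolOfMinimal = .Istar 0 := by
  obtain ⟨hΔ, n3, n4, n6, hb₂, ha₆, hb₈, hb₆⟩ := tests_of_step6 q1 q2 q3 q4 q6
  classical
  set ϖ := uniformizer R with hϖdef
  unfold WeierstrassCurve.kodairaSymbolOfMinimal
  simp only []
  -- Step 1
  have hΔm : W.Δ ∈ maximalIdeal R := mem_maximalIdeal_iff_dvd.mpr hΔ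
  rw [if_neg (not_not.mpr hΔm)]
  -- Step 2 normalisation of the algorithm, compared with `W` itself
  have hex2 := exists_variableChange_step2_of_perfectField W hΔm
  have e2 : normalizeStep2 W = hex2.choose • W := by
    unfold normalizeStep2; rw [dif_pos hex2]
  rw [e2]
  obtain ⟨hu2, p3, p4, p6⟩ := hex2.choose_spec
  have m3 := mem_maximalIdeal_iff_dvd.mp p3
  have m4 := mem_maximalIdeal_iff_dvd.mp p4
  have m6 := mem_maximalIdeal_iff_dvd.mp p6
  obtain ⟨hr₂, ht₂⟩ := dvd_r_t_of_step2 hu2 n3 n4 n6 m3 m4 m6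
  -- Step 2 test
  have hb₂' : ϖ ∣ (hex2.choose • W).b₂ := (dvd_b₂_smul_iff hu2 hr₂).mpr hb₂
  rw [if_neg (not_not.mpr (mem_maximalIdeal_iff_dvd.mpr hb₂'))]
  -- Step 3 test
  have ha₆' : ϖ ^ 2 ∣ (hex2.choose • W).a₆ := (sq_dvd_a₆_smul_iff hu2 n3 n4 hr₂ ht₂).mpr ha₆
  rw [if_neg (not_not.mpr (mem_maximalIdeal_pow_iff_dvd.mpr ha₆'))]
  -- Step 4 test
  have hb₈' : ϖ ^ 3 ∣ (hex2.choose • W).b₈ := (cube_dvd_b₈_smul_iff hu2 n3 n4 ha₆ hr₂).mpr hb₈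
  rw [if_neg (not_not.mpr (mem_maximalIdeal_pow_iff_dvd.mpr hb₈'))]
  -- Step 5 test
  have hb₆' : ϖ ^ 3 ∣ (hex2.choose • W).b₆ :=
    (cube_dvd_b₆_smul_iff hu2 n3 ha₆ hb₂ hb₈ hr₂).mpr hb₆
  rw [if_neg (not_not.mpr (mem_maximalIdeal_pow_iff_dvd.mpr hb₆'))]
  -- Step 6 normalisation of the algorithm, compared with `W`
  have hex6 := exists_variableChange_step6_of_dvd m3 m4 ha₆' hb₂' hb₆' hb₈'
  have e6 : normalizeStep6 (hex2.choose • W) = hex6.choose • (hex2.choose • W) := by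
    unfold normalizeStep6; rw [dif_pos hex6]
  rw [e6]
  obtain ⟨hu6, t1, t2, t3, t4, t6⟩ := hex6.choose_spec
  set D₆ := hex6.choose * hex2.choose with hD₆
  have hV₆ : hex6.choose • (hex2.choose • W) = D₆ • W := by rw [hD₆, mul_smul]
  have hu₆ : D₆.u = 1 := by
    rw [hD₆, WeierstrassCurve.VariableChange.mul_def]
    change hex6.choose.u * hex2.choose.u = 1
    rw [hu6, hu2, one_mul]
  clear_value D₆
  rw [hV₆] at t1 t2 t3 t4 t6 ⊢
  have r1 := mem_maximalIdeal_iff_dvd.mp t1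
  have r2 := mem_maximalIdeal_iff_dvd.mp t2
  have r3 := mem_maximalIdeal_pow_iff_dvd.mp t3
  have r4 := mem_maximalIdeal_pow_iff_dvd.mp t4
  have r6 := mem_maximalIdeal_pow_iff_dvd.mp t6
  obtain ⟨hr₆, hs₆, ht₆⟩ := dvd_r_s_t_of_step6 hu₆ q1 q2 q3 q4 q6 r1 r2 r3 r4 r6
  have c6 : distinctRootCount (cubicStep6 (D₆ • W)) = distinctRootCount (cubicStep6 W) :=
    distinctRootCount_cubicStep6_smul hu₆ q1 q2 q3 q4 q6 hr₆ hs₆ ht₆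
  -- Step 6 test fires
  rw [if_pos (by rw [c6]; exact h6)]

/-- **Steps 1–8 read on a step-8 normalised model: type `IV*`.**  If `π ∣ a₁`, `π² ∣ a₂, a₃`,
`π³ ∣ a₄`, `π⁴ ∣ a₆` (so that the step-6 cubic is `T³`) and the quadratic `Y² + a₃,₂Y - a₆,₄` has
two distinct roots in `k̄`, Tate's algorithm returns `IV*` (rigidity `dvd_r_s_t_of_step8`,
invariance `distinctRootCount_quadraticStep8_smul`).  Silverman *ATAEC* IV.9.4, Steps 1–8.
[cite: SilvermanATAEC1994, IV.9.4 Steps 1–8 (PDF pp. 344–346)] -/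
theorem kodairaSymbolOfMinimal_eq_IVstar_of_step8 [PerfectField (ResidueField R)]
    {W : WeierstrassCurve R} (y1 : uniformizer R ∣ W.a₁) (y2 : uniformizer R ^ 2 ∣ W.a₂)
    (y3 : uniformizer R ^ 2 ∣ W.a₃) (y4 : uniformizer R ^ 3 ∣ W.a₄)
    (y6 : uniformizer R ^ 4 ∣ W.a₆) (h8 : distinctRootCount (quadraticStep8 W) = 2) :
    W.kodairaSymbolOfMinimal = .IVstar := by
  have q1 := y1
  have q2 : uniformizer R ∣ W.a₂ := (dvd_pow_self _ two_ne_zero).trans y2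
  have q3 := y3
  have q4 : uniformizer R ^ 2 ∣ W.a₄ := (pow_dvd_pow _ (by norm_num)).trans y4
  have q6 : uniformizer R ^ 3 ∣ W.a₆ := (pow_dvd_pow _ (by norm_num)).trans y6
  have hcubic : distinctRootCount (cubicStep6 W) = 1 := by
    rw [cubicStep6, redCoeff_eq_zero_of_dvd (j := 1) y2, redCoeff_eq_zero_of_dvd (j := 2) y4,
      redCoeff_eq_zero_of_dvd (j := 3) y6]
    exact OggBound.distinctRootCount_cube
  have h6 : distinctRootCount (cubicStep6 W) ≠ 3 := by rw [hcubic]; decide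
  have h7 : distinctRootCount (cubicStep6 W) ≠ 2 := by rw [hcubic]; decide
  obtain ⟨hΔ, n3, n4, n6, hb₂, ha₆, hb₈, hb₆⟩ := tests_of_step6 q1 q2 q3 q4 q6
  classical
  set ϖ := uniformizer R with hϖdef
  unfold WeierstrassCurve.kodairaSymbolOfMinimal
  simp only []
  -- Step 1
  have hΔm : W.Δ ∈ maximalIdeal R := mem_maximalIdeal_iff_dvd.mpr hΔ
  rw [if_neg (not_not.mpr hΔm)]
  -- Step 2 normalisation of the algorithm, compared with `W` itself
  have hex2 := exists_variableChange_step2_of_perfectField W hΔm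
  have e2 : normalizeStep2 W = hex2.choose • W := by
    unfold normalizeStep2; rw [dif_pos hex2]
  rw [e2]
  obtain ⟨hu2, p3, p4, p6⟩ := hex2.choose_spec
  have m3 := mem_maximalIdeal_iff_dvd.mp p3
  have m4 := mem_maximalIdeal_iff_dvd.mp p4
  have m6 := mem_maximalIdeal_iff_dvd.mp p6
  obtain ⟨hr₂, ht₂⟩ := dvd_r_t_of_step2 hu2 n3 n4 n6 m3 m4 m6
  -- Step 2 test
  have hb₂' : ϖ ∣ (hex2.choose • W).b₂ := (dvd_b₂_smul_iff hu2 hr₂).mpr hb₂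
  rw [if_neg (not_not.mpr (mem_maximalIdeal_iff_dvd.mpr hb₂'))]
  -- Step 3 test
  have ha₆' : ϖ ^ 2 ∣ (hex2.choose • W).a₆ := (sq_dvd_a₆_smul_iff hu2 n3 n4 hr₂ ht₂).mpr ha₆
  rw [if_neg (not_not.mpr (mem_maximalIdeal_pow_iff_dvd.mpr ha₆'))]
  -- Step 4 test
  have hb₈' : ϖ ^ 3 ∣ (hex2.choose • W).b₈ := (cube_dvd_b₈_smul_iff hu2 n3 n4 ha₆ hr₂).mpr hb₈
  rw [if_neg (not_not.mpr (mem_maximalIdeal_pow_iff_dvd.mpr hb₈'))]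
  -- Step 5 test
  have hb₆' : ϖ ^ 3 ∣ (hex2.choose • W).b₆ :=
    (cube_dvd_b₆_smul_iff hu2 n3 ha₆ hb₂ hb₈ hr₂).mpr hb₆
  rw [if_neg (not_not.mpr (mem_maximalIdeal_pow_iff_dvd.mpr hb₆'))]
  -- Step 6 normalisation of the algorithm, compared with `W`
  have hex6 := exists_variableChange_step6_of_dvd m3 m4 ha₆' hb₂' hb₆' hb₈'
  have e6 : normalizeStep6 (hex2.choose • W) = hex6.choose • (hex2.choose • W) := by
    unfold normalizeStep6; rw [dif_pos hex6]
  rw [e6]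
  obtain ⟨hu6, t1, t2, t3, t4, t6⟩ := hex6.choose_spec
  set D₆ := hex6.choose * hex2.choose with hD₆
  have hV₆ : hex6.choose • (hex2.choose • W) = D₆ • W := by rw [hD₆, mul_smul]
  have hu₆ : D₆.u = 1 := by
    rw [hD₆, WeierstrassCurve.VariableChange.mul_def]
    change hex6.choose.u * hex2.choose.u = 1
    rw [hu6, hu2, one_mul]
  clear_value D₆
  rw [hV₆] at t1 t2 t3 t4 t6 ⊢
  have r1 := mem_maximalIdeal_iff_dvd.mp t1
  have r2 := mem_maximalIdeal_iff_dvd.mp t2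
  have r3 := mem_maximalIdeal_pow_iff_dvd.mp t3
  have r4 := mem_maximalIdeal_pow_iff_dvd.mp t4
  have r6 := mem_maximalIdeal_pow_iff_dvd.mp t6
  obtain ⟨hr₆, hs₆, ht₆⟩ := dvd_r_s_t_of_step6 hu₆ q1 q2 q3 q4 q6 r1 r2 r3 r4 r6
  have c6 : distinctRootCount (cubicStep6 (D₆ • W)) = distinctRootCount (cubicStep6 W) :=
    distinctRootCount_cubicStep6_smul hu₆ q1 q2 q3 q4 q6 hr₆ hs₆ ht₆
  -- Step 8 normalisation of the algorithm, compared with `W`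
  have h6' : distinctRootCount (cubicStep6 (D₆ • W)) ≠ 3 := by rw [c6]; exact h6
  have h7' : distinctRootCount (cubicStep6 (D₆ • W)) ≠ 2 := by rw [c6]; exact h7
  rw [if_neg h6', if_neg h7']
  have hex8 := exists_variableChange_step8_of_dvd r1 r2 r3 r4 r6 h6' h7'
  have e8 : normalizeStep8 (D₆ • W) = hex8.choose • (D₆ • W) := by
    unfold normalizeStep8; rw [dif_pos hex8]
  rw [e8]
  obtain ⟨hu8, w1, w2, w3, w4, w6⟩ := hex8.choose_spec
  set D₈ := hex8.choose * D₆ with hD₈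
  have hV₈ : hex8.choose • (D₆ • W) = D₈ • W := by rw [hD₈, mul_smul]
  have hu₈ : D₈.u = 1 := by
    rw [hD₈, WeierstrassCurve.VariableChange.mul_def]
    change hex8.choose.u * D₆.u = 1
    rw [hu8, hu₆, one_mul]
  clear_value D₈
  rw [hV₈] at w1 w2 w3 w4 w6 ⊢
  have z1 := mem_maximalIdeal_iff_dvd.mp w1
  have z2 := mem_maximalIdeal_pow_iff_dvd.mp w2
  have z3 := mem_maximalIdeal_pow_iff_dvd.mp w3
  have z4 := mem_maximalIdeal_pow_iff_dvd.mp w4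
  have z6 := mem_maximalIdeal_pow_iff_dvd.mp w6
  obtain ⟨hr₈, hs₈, ht₈⟩ := dvd_r_s_t_of_step8 hu₈ y1 y2 y3 y4 y6 z1 z2 z3 z4 z6
  have hd12 : ϖ ∣ ϖ ^ 2 := dvd_pow_self ϖ two_ne_zero
  have c8 : distinctRootCount (quadraticStep8 (D₈ • W)) = distinctRootCount (quadraticStep8 W) :=
    distinctRootCount_quadraticStep8_smul hu₈ y1 (hd12.trans y2) y3 y4 y6 hr₈ hs₈ ht₈
  -- Step 8 test fires
  rw [if_pos (by rw [c8]; exact h8)]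

/-- **Steps 1–9 read on a step-9 normalised model: type `III*`.**  If `π ∣ a₁`, `π² ∣ a₂`,
`π³ ∣ a₃, a₄`, `π⁵ ∣ a₆` (so that the step-6 cubic is `T³` and the step-8 quadratic is `Y²`) and
`π⁴ ∤ a₄`, Tate's algorithm returns `III*` (rigidity `dvd_r_s_t_of_step9`, invariance
`pow_four_dvd_a₄_smul_iff`).  Silverman *ATAEC* IV.9.4, Steps 1–9.
[cite: SilvermanATAEC1994, IV.9.4 Steps 1–9 (PDF pp. 344–346)] -/
theorem kodairaSymbolOfMinimal_eq_IIIstar_of_step9 [PerfectField (ResidueField R)]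
    {W : WeierstrassCurve R} (g1 : uniformizer R ∣ W.a₁) (g2 : uniformizer R ^ 2 ∣ W.a₂)
    (g3 : uniformizer R ^ 3 ∣ W.a₃) (g4 : uniformizer R ^ 3 ∣ W.a₄)
    (g6 : uniformizer R ^ 5 ∣ W.a₆) (h9 : ¬ uniformizer R ^ 4 ∣ W.a₄) :
    W.kodairaSymbolOfMinimal = .IIIstar := by
  have y1 := g1
  have y2 := g2
  have y3 : uniformizer R ^ 2 ∣ W.a₃ := (pow_dvd_pow _ (by norm_num)).trans g3
  have y4 := g4
  have y6 : uniformizer R ^ 4 ∣ W.a₆ := (pow_dvd_pow _ (by norm_num)).trans g6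
  have q1 := y1
  have q2 : uniformizer R ∣ W.a₂ := (dvd_pow_self _ two_ne_zero).trans y2
  have q3 := y3
  have q4 : uniformizer R ^ 2 ∣ W.a₄ := (pow_dvd_pow _ (by norm_num)).trans y4
  have q6 : uniformizer R ^ 3 ∣ W.a₆ := (pow_dvd_pow _ (by norm_num)).trans y6
  have hcubic : distinctRootCount (cubicStep6 W) = 1 := by
    rw [cubicStep6, redCoeff_eq_zero_of_dvd (j := 1) y2, redCoeff_eq_zero_of_dvd (j := 2) y4,
      redCoeff_eq_zero_of_dvd (j := 3) y6]
    exact OggBound.distinctRootCount_cube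
  have h6 : distinctRootCount (cubicStep6 W) ≠ 3 := by rw [hcubic]; decide
  have h7 : distinctRootCount (cubicStep6 W) ≠ 2 := by rw [hcubic]; decide
  have h8 : distinctRootCount (quadraticStep8 W) ≠ 2 := by
    rw [quadraticStep8, redCoeff_eq_zero_of_dvd (j := 2) g3, redCoeff_eq_zero_of_dvd (j := 4) g6,
      Ne, distinctRootCount_sq_add_sub_eq_two_iff, not_not]
    ring
  obtain ⟨hΔ, n3, n4, n6, hb₂, ha₆, hb₈, hb₆⟩ := tests_of_step6 q1 q2 q3 q4 q6
  classical
  set ϖ := uniformizer R with hϖdef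
  unfold WeierstrassCurve.kodairaSymbolOfMinimal
  simp only []
  -- Step 1
  have hΔm : W.Δ ∈ maximalIdeal R := mem_maximalIdeal_iff_dvd.mpr hΔ
  rw [if_neg (not_not.mpr hΔm)]
  -- Step 2 normalisation of the algorithm, compared with `W` itself
  have hex2 := exists_variableChange_step2_of_perfectField W hΔm
  have e2 : normalizeStep2 W = hex2.choose • W := by
    unfold normalizeStep2; rw [dif_pos hex2]
  rw [e2]
  obtain ⟨hu2, p3, p4, p6⟩ := hex2.choose_spec
  have m3 := mem_maximalIdeal_iff_dvd.mp p3
  have m4 := mem_maximalIdeal_iff_dvd.mp p4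
  have m6 := mem_maximalIdeal_iff_dvd.mp p6
  obtain ⟨hr₂, ht₂⟩ := dvd_r_t_of_step2 hu2 n3 n4 n6 m3 m4 m6
  -- Step 2 test
  have hb₂' : ϖ ∣ (hex2.choose • W).b₂ := (dvd_b₂_smul_iff hu2 hr₂).mpr hb₂
  rw [if_neg (not_not.mpr (mem_maximalIdeal_iff_dvd.mpr hb₂'))]
  -- Step 3 test
  have ha₆' : ϖ ^ 2 ∣ (hex2.choose • W).a₆ := (sq_dvd_a₆_smul_iff hu2 n3 n4 hr₂ ht₂).mpr ha₆
  rw [if_neg (not_not.mpr (mem_maximalIdeal_pow_iff_dvd.mpr ha₆'))]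
  -- Step 4 test
  have hb₈' : ϖ ^ 3 ∣ (hex2.choose • W).b₈ := (cube_dvd_b₈_smul_iff hu2 n3 n4 ha₆ hr₂).mpr hb₈
  rw [if_neg (not_not.mpr (mem_maximalIdeal_pow_iff_dvd.mpr hb₈'))]
  -- Step 5 test
  have hb₆' : ϖ ^ 3 ∣ (hex2.choose • W).b₆ :=
    (cube_dvd_b₆_smul_iff hu2 n3 ha₆ hb₂ hb₈ hr₂).mpr hb₆
  rw [if_neg (not_not.mpr (mem_maximalIdeal_pow_iff_dvd.mpr hb₆'))]
  -- Step 6 normalisation of the algorithm, compared with `W`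
  have hex6 := exists_variableChange_step6_of_dvd m3 m4 ha₆' hb₂' hb₆' hb₈'
  have e6 : normalizeStep6 (hex2.choose • W) = hex6.choose • (hex2.choose • W) := by
    unfold normalizeStep6; rw [dif_pos hex6]
  rw [e6]
  obtain ⟨hu6, t1, t2, t3, t4, t6⟩ := hex6.choose_spec
  set D₆ := hex6.choose * hex2.choose with hD₆
  have hV₆ : hex6.choose • (hex2.choose • W) = D₆ • W := by rw [hD₆, mul_smul]
  have hu₆ : D₆.u = 1 := by
    rw [hD₆, WeierstrassCurve.VariableChange.mul_def]
    change hex6.choose.u * hex2.choose.u = 1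
    rw [hu6, hu2, one_mul]
  clear_value D₆
  rw [hV₆] at t1 t2 t3 t4 t6 ⊢
  have r1 := mem_maximalIdeal_iff_dvd.mp t1
  have r2 := mem_maximalIdeal_iff_dvd.mp t2
  have r3 := mem_maximalIdeal_pow_iff_dvd.mp t3
  have r4 := mem_maximalIdeal_pow_iff_dvd.mp t4
  have r6 := mem_maximalIdeal_pow_iff_dvd.mp t6
  obtain ⟨hr₆, hs₆, ht₆⟩ := dvd_r_s_t_of_step6 hu₆ q1 q2 q3 q4 q6 r1 r2 r3 r4 r6
  have c6 : distinctRootCount (cubicStep6 (D₆ • W)) = distinctRootCount (cubicStep6 W) :=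
    distinctRootCount_cubicStep6_smul hu₆ q1 q2 q3 q4 q6 hr₆ hs₆ ht₆
  -- Step 8 normalisation of the algorithm, compared with `W`
  have h6' : distinctRootCount (cubicStep6 (D₆ • W)) ≠ 3 := by rw [c6]; exact h6
  have h7' : distinctRootCount (cubicStep6 (D₆ • W)) ≠ 2 := by rw [c6]; exact h7
  rw [if_neg h6', if_neg h7']
  have hex8 := exists_variableChange_step8_of_dvd r1 r2 r3 r4 r6 h6' h7'
  have e8 : normalizeStep8 (D₆ • W) = hex8.choose • (D₆ • W) := by
    unfold normalizeStep8; rw [dif_pos hex8]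
  rw [e8]
  obtain ⟨hu8, w1, w2, w3, w4, w6⟩ := hex8.choose_spec
  set D₈ := hex8.choose * D₆ with hD₈
  have hV₈ : hex8.choose • (D₆ • W) = D₈ • W := by rw [hD₈, mul_smul]
  have hu₈ : D₈.u = 1 := by
    rw [hD₈, WeierstrassCurve.VariableChange.mul_def]
    change hex8.choose.u * D₆.u = 1
    rw [hu8, hu₆, one_mul]
  clear_value D₈
  rw [hV₈] at w1 w2 w3 w4 w6 ⊢
  have z1 := mem_maximalIdeal_iff_dvd.mp w1
  have z2 := mem_maximalIdeal_pow_iff_dvd.mp w2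
  have z3 := mem_maximalIdeal_pow_iff_dvd.mp w3
  have z4 := mem_maximalIdeal_pow_iff_dvd.mp w4
  have z6 := mem_maximalIdeal_pow_iff_dvd.mp w6
  obtain ⟨hr₈, hs₈, ht₈⟩ := dvd_r_s_t_of_step8 hu₈ y1 y2 y3 y4 y6 z1 z2 z3 z4 z6
  have hd12 : ϖ ∣ ϖ ^ 2 := dvd_pow_self ϖ two_ne_zero
  have c8 : distinctRootCount (quadraticStep8 (D₈ • W)) = distinctRootCount (quadraticStep8 W) :=
    distinctRootCount_quadraticStep8_smul hu₈ y1 (hd12.trans y2) y3 y4 y6 hr₈ hs₈ ht₈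
  -- Step 9 normalisation of the algorithm, compared with `W`
  have h8' : distinctRootCount (quadraticStep8 (D₈ • W)) ≠ 2 := by rw [c8]; exact h8
  rw [if_neg h8']
  have hex9 := exists_variableChange_step9_of_dvd z1 z2 z3 z4 z6 h8'
  have e9 : normalizeStep9 (D₈ • W) = hex9.choose • (D₈ • W) := by
    unfold normalizeStep9; rw [dif_pos hex9]
  rw [e9]
  obtain ⟨hu9, o1, o2, o3, o4, o6⟩ := hex9.choose_spec
  set D₉ := hex9.choose * D₈ with hD₉
  have hV₉ : hex9.choose • (D₈ • W) = D₉ • W := by rw [hD₉, mul_smul]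
  have hu₉ : D₉.u = 1 := by
    rw [hD₉, WeierstrassCurve.VariableChange.mul_def]
    change hex9.choose.u * D₈.u = 1
    rw [hu9, hu₈, one_mul]
  clear_value D₉
  rw [hV₉] at o1 o2 o3 o4 o6 ⊢
  have f1 := mem_maximalIdeal_iff_dvd.mp o1
  have f2 := mem_maximalIdeal_pow_iff_dvd.mp o2
  have f3 := mem_maximalIdeal_pow_iff_dvd.mp o3
  have f4 := mem_maximalIdeal_pow_iff_dvd.mp o4
  have f6 := mem_maximalIdeal_pow_iff_dvd.mp o6
  obtain ⟨hr₉, hs₉, ht₉⟩ := dvd_r_s_t_of_step9 hu₉ g1 g2 g3 g4 g6 f1 f2 f3 f4 f6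
  -- Step 9 test fires
  have h9' : ¬ ϖ ^ 4 ∣ (D₉ • W).a₄ := by
    rw [pow_four_dvd_a₄_smul_iff hu₉ g1 g2 g3 hr₉ hs₉ ht₉]; exact h9
  rw [if_pos (fun h ↦ h9' (mem_maximalIdeal_pow_iff_dvd.mp h))]

/-- **Steps 1–10 read on a step-9 normalised model: type `II*`.**  If `π ∣ a₁`, `π² ∣ a₂`,
`π³ ∣ a₃`, `π⁴ ∣ a₄`, `π⁵ ∣ a₆` and `π⁶ ∤ a₆`, Tate's algorithm returns `II*` (rigidity
`dvd_r_s_t_of_step9`, invariance `pow_four_dvd_a₄_smul_iff`, `pow_six_dvd_a₆_smul_iff`).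
Silverman *ATAEC* IV.9.4, Steps 1–10. [cite: SilvermanATAEC1994, IV.9.4 Steps 1–10 (PDF pp. 344–346)] -/
theorem kodairaSymbolOfMinimal_eq_IIstar_of_step9 [PerfectField (ResidueField R)]
    {W : WeierstrassCurve R} (g1 : uniformizer R ∣ W.a₁) (g2 : uniformizer R ^ 2 ∣ W.a₂)
    (g3 : uniformizer R ^ 3 ∣ W.a₃) (g4' : uniformizer R ^ 4 ∣ W.a₄)
    (g6 : uniformizer R ^ 5 ∣ W.a₆) (h10 : ¬ uniformizer R ^ 6 ∣ W.a₆) :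
    W.kodairaSymbolOfMinimal = .IIstar := by
  have g4 : uniformizer R ^ 3 ∣ W.a₄ := (pow_dvd_pow _ (by norm_num)).trans g4'
  have y1 := g1
  have y2 := g2
  have y3 : uniformizer R ^ 2 ∣ W.a₃ := (pow_dvd_pow _ (by norm_num)).trans g3
  have y4 := g4
  have y6 : uniformizer R ^ 4 ∣ W.a₆ := (pow_dvd_pow _ (by norm_num)).trans g6
  have q1 := y1
  have q2 : uniformizer R ∣ W.a₂ := (dvd_pow_self _ two_ne_zero).trans y2
  have q3 := y3
  have q4 : uniformizer R ^ 2 ∣ W.a₄ := (pow_dvd_pow _ (by norm_num)).trans y4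
  have q6 : uniformizer R ^ 3 ∣ W.a₆ := (pow_dvd_pow _ (by norm_num)).trans y6
  have hcubic : distinctRootCount (cubicStep6 W) = 1 := by
    rw [cubicStep6, redCoeff_eq_zero_of_dvd (j := 1) y2, redCoeff_eq_zero_of_dvd (j := 2) y4,
      redCoeff_eq_zero_of_dvd (j := 3) y6]
    exact OggBound.distinctRootCount_cube
  have h6 : distinctRootCount (cubicStep6 W) ≠ 3 := by rw [hcubic]; decide
  have h7 : distinctRootCount (cubicStep6 W) ≠ 2 := by rw [hcubic]; decide
  have h8 : distinctRootCount (quadraticStep8 W) ≠ 2 := by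
    rw [quadraticStep8, redCoeff_eq_zero_of_dvd (j := 2) g3, redCoeff_eq_zero_of_dvd (j := 4) g6,
      Ne, distinctRootCount_sq_add_sub_eq_two_iff, not_not]
    ring
  obtain ⟨hΔ, n3, n4, n6, hb₂, ha₆, hb₈, hb₆⟩ := tests_of_step6 q1 q2 q3 q4 q6
  classical
  set ϖ := uniformizer R with hϖdef
  unfold WeierstrassCurve.kodairaSymbolOfMinimal
  simp only []
  -- Step 1
  have hΔm : W.Δ ∈ maximalIdeal R := mem_maximalIdeal_iff_dvd.mpr hΔ
  rw [if_neg (not_not.mpr hΔm)]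
  -- Step 2 normalisation of the algorithm, compared with `W` itself
  have hex2 := exists_variableChange_step2_of_perfectField W hΔm
  have e2 : normalizeStep2 W = hex2.choose • W := by
    unfold normalizeStep2; rw [dif_pos hex2]
  rw [e2]
  obtain ⟨hu2, p3, p4, p6⟩ := hex2.choose_spec
  have m3 := mem_maximalIdeal_iff_dvd.mp p3
  have m4 := mem_maximalIdeal_iff_dvd.mp p4
  have m6 := mem_maximalIdeal_iff_dvd.mp p6
  obtain ⟨hr₂, ht₂⟩ := dvd_r_t_of_step2 hu2 n3 n4 n6 m3 m4 m6
  -- Step 2 test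
  have hb₂' : ϖ ∣ (hex2.choose • W).b₂ := (dvd_b₂_smul_iff hu2 hr₂).mpr hb₂
  rw [if_neg (not_not.mpr (mem_maximalIdeal_iff_dvd.mpr hb₂'))]
  -- Step 3 test
  have ha₆' : ϖ ^ 2 ∣ (hex2.choose • W).a₆ := (sq_dvd_a₆_smul_iff hu2 n3 n4 hr₂ ht₂).mpr ha₆
  rw [if_neg (not_not.mpr (mem_maximalIdeal_pow_iff_dvd.mpr ha₆'))]
  -- Step 4 test
  have hb₈' : ϖ ^ 3 ∣ (hex2.choose • W).b₈ := (cube_dvd_b₈_smul_iff hu2 n3 n4 ha₆ hr₂).mpr hb₈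
  rw [if_neg (not_not.mpr (mem_maximalIdeal_pow_iff_dvd.mpr hb₈'))]
  -- Step 5 test
  have hb₆' : ϖ ^ 3 ∣ (hex2.choose • W).b₆ :=
    (cube_dvd_b₆_smul_iff hu2 n3 ha₆ hb₂ hb₈ hr₂).mpr hb₆
  rw [if_neg (not_not.mpr (mem_maximalIdeal_pow_iff_dvd.mpr hb₆'))]
  -- Step 6 normalisation of the algorithm, compared with `W`
  have hex6 := exists_variableChange_step6_of_dvd m3 m4 ha₆' hb₂' hb₆' hb₈'
  have e6 : normalizeStep6 (hex2.choose • W) = hex6.choose • (hex2.choose • W) := by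
    unfold normalizeStep6; rw [dif_pos hex6]
  rw [e6]
  obtain ⟨hu6, t1, t2, t3, t4, t6⟩ := hex6.choose_spec
  set D₆ := hex6.choose * hex2.choose with hD₆
  have hV₆ : hex6.choose • (hex2.choose • W) = D₆ • W := by rw [hD₆, mul_smul]
  have hu₆ : D₆.u = 1 := by
    rw [hD₆, WeierstrassCurve.VariableChange.mul_def]
    change hex6.choose.u * hex2.choose.u = 1
    rw [hu6, hu2, one_mul]
  clear_value D₆
  rw [hV₆] at t1 t2 t3 t4 t6 ⊢
  have r1 := mem_maximalIdeal_iff_dvd.mp t1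
  have r2 := mem_maximalIdeal_iff_dvd.mp t2
  have r3 := mem_maximalIdeal_pow_iff_dvd.mp t3
  have r4 := mem_maximalIdeal_pow_iff_dvd.mp t4
  have r6 := mem_maximalIdeal_pow_iff_dvd.mp t6
  obtain ⟨hr₆, hs₆, ht₆⟩ := dvd_r_s_t_of_step6 hu₆ q1 q2 q3 q4 q6 r1 r2 r3 r4 r6
  have c6 : distinctRootCount (cubicStep6 (D₆ • W)) = distinctRootCount (cubicStep6 W) :=
    distinctRootCount_cubicStep6_smul hu₆ q1 q2 q3 q4 q6 hr₆ hs₆ ht₆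
  -- Step 8 normalisation of the algorithm, compared with `W`
  have h6' : distinctRootCount (cubicStep6 (D₆ • W)) ≠ 3 := by rw [c6]; exact h6
  have h7' : distinctRootCount (cubicStep6 (D₆ • W)) ≠ 2 := by rw [c6]; exact h7
  rw [if_neg h6', if_neg h7']
  have hex8 := exists_variableChange_step8_of_dvd r1 r2 r3 r4 r6 h6' h7'
  have e8 : normalizeStep8 (D₆ • W) = hex8.choose • (D₆ • W) := by
    unfold normalizeStep8; rw [dif_pos hex8]
  rw [e8]
  obtain ⟨hu8, w1, w2, w3, w4, w6⟩ := hex8.choose_spec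
  set D₈ := hex8.choose * D₆ with hD₈
  have hV₈ : hex8.choose • (D₆ • W) = D₈ • W := by rw [hD₈, mul_smul]
  have hu₈ : D₈.u = 1 := by
    rw [hD₈, WeierstrassCurve.VariableChange.mul_def]
    change hex8.choose.u * D₆.u = 1
    rw [hu8, hu₆, one_mul]
  clear_value D₈
  rw [hV₈] at w1 w2 w3 w4 w6 ⊢
  have z1 := mem_maximalIdeal_iff_dvd.mp w1
  have z2 := mem_maximalIdeal_pow_iff_dvd.mp w2
  have z3 := mem_maximalIdeal_pow_iff_dvd.mp w3
  have z4 := mem_maximalIdeal_pow_iff_dvd.mp w4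
  have z6 := mem_maximalIdeal_pow_iff_dvd.mp w6
  obtain ⟨hr₈, hs₈, ht₈⟩ := dvd_r_s_t_of_step8 hu₈ y1 y2 y3 y4 y6 z1 z2 z3 z4 z6
  have hd12 : ϖ ∣ ϖ ^ 2 := dvd_pow_self ϖ two_ne_zero
  have c8 : distinctRootCount (quadraticStep8 (D₈ • W)) = distinctRootCount (quadraticStep8 W) :=
    distinctRootCount_quadraticStep8_smul hu₈ y1 (hd12.trans y2) y3 y4 y6 hr₈ hs₈ ht₈
  -- Step 9 normalisation of the algorithm, compared with `W`
  have h8' : distinctRootCount (quadraticStep8 (D₈ • W)) ≠ 2 := by rw [c8]; exact h8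
  rw [if_neg h8']
  have hex9 := exists_variableChange_step9_of_dvd z1 z2 z3 z4 z6 h8'
  have e9 : normalizeStep9 (D₈ • W) = hex9.choose • (D₈ • W) := by
    unfold normalizeStep9; rw [dif_pos hex9]
  rw [e9]
  obtain ⟨hu9, o1, o2, o3, o4, o6⟩ := hex9.choose_spec
  set D₉ := hex9.choose * D₈ with hD₉
  have hV₉ : hex9.choose • (D₈ • W) = D₉ • W := by rw [hD₉, mul_smul]
  have hu₉ : D₉.u = 1 := by
    rw [hD₉, WeierstrassCurve.VariableChange.mul_def]
    change hex9.choose.u * D₈.u = 1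
    rw [hu9, hu₈, one_mul]
  clear_value D₉
  rw [hV₉] at o1 o2 o3 o4 o6 ⊢
  have f1 := mem_maximalIdeal_iff_dvd.mp o1
  have f2 := mem_maximalIdeal_pow_iff_dvd.mp o2
  have f3 := mem_maximalIdeal_pow_iff_dvd.mp o3
  have f4 := mem_maximalIdeal_pow_iff_dvd.mp o4
  have f6 := mem_maximalIdeal_pow_iff_dvd.mp o6
  obtain ⟨hr₉, hs₉, ht₉⟩ := dvd_r_s_t_of_step9 hu₉ g1 g2 g3 g4 g6 f1 f2 f3 f4 f6
  -- Step 9 test fails, Step 10 test fires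
  have h9' : ϖ ^ 4 ∣ (D₉ • W).a₄ := by
    rw [pow_four_dvd_a₄_smul_iff hu₉ g1 g2 g3 hr₉ hs₉ ht₉]; exact g4'
  rw [if_neg (not_not.mpr (mem_maximalIdeal_pow_iff_dvd.mpr h9'))]
  have h10' : ¬ ϖ ^ 6 ∣ (D₉ • W).a₆ := by
    rw [pow_six_dvd_a₆_smul_iff hu₉ g1 g2 g3 g4' hr₉ ht₉]; exact h10
  rw [if_pos (fun h ↦ h10' (mem_maximalIdeal_pow_iff_dvd.mp h))]

end TateAlgorithm

end Literature.NumberTheory.DiophantineGeometry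

end
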